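import Summits.AtomisticToContinuum.Crystallization.Theorems.ChartedZeroExcessLayeredLatticeLiouvilleZP

/-!
# Part ZQ «Non-empty container junction» (lens-2 g79, NODE 79 — part 7 of 7; sequel of `…LatticeLiouvilleZP`)

THE EMPTY-CONTAINER CORNER DISSOLVED.  At `K = ∅` the target (GL) `BondLabelP` is VACUOUS — every clause of `IsBondLabel ε r ℓ S K C lab` quantifies over
the zone `{p | ∃ k ∈ K, dist p k < ℓ}`, empty, and `lab := id` is a label — while (L2-C) `CoolShadowLinearChartP` is NOT (it still asks for a chart of the
crystal).  So the junction of NODE 78 (tree ZK, `bondLabelP_of_pinning_linearChart`) only ever needs (L2-C) ON NON-EMPTY CONTAINERS: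

★★★ `bondLabelP_of_pinning_linearChart_nonempty` (PROVED):  (L2-S) `DoorChartPinningP … R₀ Rp R₁` ∧ (L2-C≠∅) `CoolShadowLinearChartNonemptyP
… R₁ RC η` ⟹ (GL) `BondLabelP …` under the same numeric side conditions as tree ZK — the proof IS tree ZK's construction VERBATIM (shell label on the cool zone,
`comb_extension` read in coordinates inside, pinned anchors; see the module docstring of tree ZK), preceded by the two-line `K = ∅` branch; it is repeated
here only because the landed theorem consumes (L2-C) as a whole `Prop` (a tree refactor could instead generalise ZK in place and derive it).

★★ (L2-C≠∅) ⟺ (L2-C∥) ∧ (L2-C⟂) (`nonempty_iff_parallel_oblique`): both case pieces of part ZP carry `K.Nonempty`, so on non-empty containers the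
structural dichotomy is exactly PARALLEL [PROVED, ZP] versus OBLIQUE [open] — no third corner.

★★★ NODE 79 JUNCTION OF RECORD `bondLabelP_record_of_oblique` (PROVED):  (GL) ⟸ (L2-S)(14, 57/4, 82/5) [open, NODE 78] ∧ (L2-C⟂)(82/5, 821/50, 1/100)
[open] at the lineage record `(ϑp, r, q, rsh, rm, σ, ϑr, Rs, ε, rI, ℓ, aHi, Λ, θ, s) = (1/10, 8, 4, 12, 16, 17/20, 10⁻⁴, 5, 10⁻⁴, 10, 43/2, 1,
2, 1/16, 1/50)`, `ϑc` free; and `oblique_record_of_coolShadowLinearChartP_record`: the open piece follows from NODE 78's record (L2-C)(82/5, 33/2, 1/100) — NODE 79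
refines NODE 78.  0 sorry; standard axioms.
-/

noncomputable section
open scoped BigOperators Classical InnerProductSpace RealInnerProductSpace
open MeasureTheory Set Metric Filter Topology
open Summit.AtomisticToContinuum.Crystallization.Theorems.ChartedPlanarOrderRigidityDoor (E3 IsClean IsCharted)
open Summit.AtomisticToContinuum.Crystallization.Theorems.ChartedPlanarOrderDensityDichotomy (μS IsSep)
open Summit.AtomisticToContinuum.Crystallization.Theorems.ChartedPlanarOrderCleanScaleP (IsCleanP IsDoorSetP isCleanP_one_iff isCleanP_μS_iff)
open Summit.AtomisticToContinuum.Crystallization.Theorems.ChartedPlanarOrderMesoCut (LayeredHom EnvClose)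
open Summit.AtomisticToContinuum.Crystallization.Theorems.ChartedPlanarOrderDoorLayeredOsc (IsTwoShellAffineGood mem_iff_μS_singleton_ne_zero)
open Literature.MathematicalPhysics.StatisticalMechanics (lennardJones triangularVec₁ triangularVec₂)
open Literature.Geometry.DiscreteGeometry (IsTwoShellGoodSet)

namespace Summit.AtomisticToContinuum.Crystallization.Theorems.ChartedZeroExcessLayeredLatticeLiouville

/-! ## ZQ-1  (L2-C) on non-empty containers -/

/-- ★ (L2-C≠∅) «CoolShadowLinearChartNonemptyP»: (L2-C) `CoolShadowLinearChartP` restricted to NON-EMPTY containers `K` — all that (GL) needs. -/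
def CoolShadowLinearChartNonemptyP (ϑc ϑp r q rsh rm σ ϑr Rs ε rI ℓ aHi Λ θ s R₁ RC η : ℝ) : Prop :=
  CoolShadowLinearChartUnderP (fun _ K _ _ _ _ _ => K.Nonempty) ϑc ϑp r q rsh rm σ ϑr Rs ε rI ℓ aHi Λ θ s R₁ RC η

/-- (L2-C) gives (L2-C≠∅). [formal bookkeeping] -/
theorem nonempty_of_coolShadowLinearChartP {ϑc ϑp r q rsh rm σ ϑr Rs ε rI ℓ aHi Λ θ s R₁ RC η : ℝ}
    (h : CoolShadowLinearChartP ϑc ϑp r q rsh rm σ ϑr Rs ε rI ℓ aHi Λ θ s R₁ RC η) :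
    CoolShadowLinearChartNonemptyP ϑc ϑp r q rsh rm σ ϑr Rs ε rI ℓ aHi Λ θ s R₁ RC η :=
  under_of_coolShadowLinearChartP _ h

/-- ★★ JUNCTION (PROVED): (L2-C≠∅) ⟸ (L2-C∥) ∧ (L2-C⟂). [this file] -/
theorem nonempty_of_parallel_oblique {ϑc ϑp r q rsh rm σ ϑr Rs ε rI ℓ aHi Λ θ s R₁ RC η : ℝ}
    (hP : CoolShadowLinearChartParallelP ϑc ϑp r q rsh rm σ ϑr Rs ε rI ℓ aHi Λ θ s R₁ RC η)
    (hO : CoolShadowLinearChartObliqueP ϑc ϑp r q rsh rm σ ϑr Rs ε rI ℓ aHi Λ θ s R₁ RC η) :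
    CoolShadowLinearChartNonemptyP ϑc ϑp r q rsh rm σ ϑr Rs ε rI ℓ aHi Λ θ s R₁ RC η := by
  intro δ hδ a ha S hSd hsum hgood L w hL x₀ K hKS hKq hTp hTc L' w' U t hcr Ψ τ hΨ hsurj hne
  by_cases h : IsParallelReg ε r ℓ S K Ψ L' w' U t
  · exact hP δ hδ a ha S hSd hsum hgood L w hL x₀ K hKS hKq hTp hTc L' w' U t hcr Ψ τ hΨ hsurj ⟨hne, h⟩
  · exact hO δ hδ a ha S hSd hsum hgood L w hL x₀ K hKS hKq hTp hTc L' w' U t hcr Ψ τ hΨ hsurj ⟨hne, h⟩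

/-- ★★ THE EQUIV LAYER OF NODE 79: (L2-C≠∅) ⟺ (L2-C∥) ∧ (L2-C⟂) — on non-empty containers the dichotomy has no third corner. [this file] -/
theorem nonempty_iff_parallel_oblique (ϑc ϑp r q rsh rm σ ϑr Rs ε rI ℓ aHi Λ θ s R₁ RC η : ℝ) :
    CoolShadowLinearChartNonemptyP ϑc ϑp r q rsh rm σ ϑr Rs ε rI ℓ aHi Λ θ s R₁ RC η ↔
      CoolShadowLinearChartParallelP ϑc ϑp r q rsh rm σ ϑr Rs ε rI ℓ aHi Λ θ s R₁ RC η ∧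
        CoolShadowLinearChartObliqueP ϑc ϑp r q rsh rm σ ϑr Rs ε rI ℓ aHi Λ θ s R₁ RC η :=
  ⟨fun h =>
      ⟨under_mono_case (fun S K Ψ L' w' U t (hQ : K.Nonempty ∧ IsParallelReg ε r ℓ S K Ψ L' w' U t) => hQ.1) h,
        under_mono_case (fun S K Ψ L' w' U t (hQ : K.Nonempty ∧ ¬ IsParallelReg ε r ℓ S K Ψ L' w' U t) => hQ.1) h⟩,
    fun h => nonempty_of_parallel_oblique h.1 h.2⟩

/-! ## ZQ-2  The junction on non-empty containers (tree ZK's construction, with the vacuous empty branch in front) -/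

/-- ★★★ **(L2-S) ∧ (L2-C≠∅) ⟹ (GL) (PROVED)** — tree ZK's `bondLabelP_of_pinning_linearChart` with (L2-C) needed on non-empty containers only; at `K = ∅`
the identity is a bond label.  The non-empty branch is tree ZK's proof verbatim. -/
theorem bondLabelP_of_pinning_linearChart_nonempty {ϑc ϑp r q rsh rm σ ϑr Rs ε rI ℓ aHi Λ θ s R₀ Rp R₁ RC η : ℝ}
    (haHi : aHi ≤ 1) (hε₀ : 0 ≤ ε) (hε : ε ≤ 1 / 40) (hη : 0 ≤ η) (h₀ : R₀ + 2 * ε + 2 * η ≤ Rp) (h₁ : Rp ≤ R₁) (h₂ : R₁ + ε ≤ RC)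
    (hPin : DoorChartPinningP ϑc ϑp r q rsh rm σ ϑr Rs ε rI ℓ aHi Λ θ s R₀ Rp R₁)
    (hLin : CoolShadowLinearChartNonemptyP ϑc ϑp r q rsh rm σ ϑr Rs ε rI ℓ aHi Λ θ s R₁ RC η) :
    BondLabelP ϑc ϑp r q rsh rm σ ϑr Rs ε rI ℓ aHi Λ θ s := by
  intro δ hδ a ha S hSd hsum hgood L w hL x₀ K hKS hKq hTp hTc L' w' U t hcr
  -- the empty container: every clause of a bond label quantifies over the (empty) zone, and the identity is a label
  by_cases hK : K = ∅
  · subst hK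
    exact ⟨id, fun p _ ⟨k, hk, _⟩ => (Set.notMem_empty k hk).elim, fun p _ p' _ ⟨k, hk, _⟩ => (Set.notMem_empty k hk).elim,
      Set.injOn_id _, fun p _ ⟨k, hk, _⟩ => (Set.notMem_empty k hk).elim⟩
  have hKne : K.Nonempty := Set.nonempty_iff_ne_empty.2 hK
  obtain ⟨Ψ, τS, hΨ, hsurj⟩ := exists_globalChart_of_isCharted hSd.2.2.2.2
  obtain ⟨kLo, kHi, base, hIrng, hbase, hpin, hweld, hbtw, hadj⟩ :=
    hPin δ hδ a ha S hSd hsum hgood L w hL x₀ K hKS hKq hTp hTc L' w' U t hcr Ψ τS hΨ hsurj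
  obtain ⟨ΨC, o, b₁, b₂, τC, hchart, hcov, hcompat, hlin⟩ :=
    hLin δ hδ a ha S hSd hsum hgood L w hL x₀ K hKS hKq hTp hTc L' w' U t hcr Ψ τS hΨ hsurj hKne
  obtain ⟨lab₀, hl₁, hl₂, hl₃, hl₄⟩ := shell_bondLabel haHi hSd hε hcr
  -- abbreviations and elementary inclusions
  set C : Set E3 := placedCrystal L' w' U t with hC
  set Λ₀ : ℤ × ℤ × ℤ → E3 := linChart o b₁ b₂ with hΛ₀
  set R : Set (ℤ × ℤ × ℤ) := zoneCoords Ψ S K r ℓ R₁ x₀ with hR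
  set P : Set (ℤ × ℤ × ℤ) := zoneCoords Ψ S K r ℓ Rp x₀ with hP
  set B : Set (ℤ × ℤ × ℤ) := zoneCoords Ψ S K r ℓ R₀ x₀ with hB
  set I : Set (ℤ × ℤ × ℤ) := coreCoords Ψ S K r with hI
  have hPR : P ⊆ R := zoneCoords_mono Ψ S K r ℓ x₀ h₁
  have hBP : B ⊆ P := zoneCoords_mono Ψ S K r ℓ x₀ (by linarith)
  have hRC₀ : R₀ + ε + 2 * η ≤ RC := by linarith
  have hexS : ∀ x y, IsBond (Ψ x) (Ψ y) ↔ BarlowAdj τS x y := fun x y => hΨ.2.2 x (Set.mem_univ _) y (Set.mem_univ _)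
  have hinjS : ∀ x y, Ψ x = Ψ y → x = y := fun x y h => hΨ.1 (Set.mem_univ _) (Set.mem_univ _) h
  -- the shell label read in coordinates
  have hf₀ex : ∀ x : ℤ × ℤ × ℤ, ∃ y : ℤ × ℤ × ℤ, x ∈ R → ΨC y = lab₀ (Ψ x) := by
    intro x
    by_cases hx : x ∈ R
    · obtain ⟨hm, hd⟩ := hx
      have hin : lab₀ (Ψ x) ∈ C := hl₁ _ ⟨hm.1, hm.2.2⟩ hm.2.1
      have hdε : dist (Ψ x) (lab₀ (Ψ x)) ≤ ε := hl₄ _ ⟨hm.1, hm.2.2⟩ hm.2.1 hm.2.2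
      have hd' : dist (lab₀ (Ψ x)) x₀ ≤ RC := by
        have ht := dist_triangle (lab₀ (Ψ x)) (Ψ x) x₀
        rw [dist_comm (lab₀ (Ψ x)) (Ψ x)] at ht
        linarith
      obtain ⟨y, hy⟩ := hcov _ hin hd'
      exact ⟨y, fun _ => hy⟩
    · exact ⟨x, fun h => absurd h hx⟩
  choose f₀ hf₀ using hf₀ex
  have f1 : ∀ x ∈ R, ΨC (f₀ x) = lab₀ (Ψ x) := fun x hx => hf₀ x hx
  have fdist : ∀ x ∈ R, dist (Ψ x) (ΨC (f₀ x)) ≤ ε := fun x hx => by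
    rw [f1 x hx]; exact hl₄ _ ⟨hx.1.1, hx.1.2.2⟩ hx.1.2.1 hx.1.2.2
  have f2 : ∀ x ∈ R, dist (ΨC (f₀ x)) x₀ ≤ RC := fun x hx => by
    have ht := dist_triangle (ΨC (f₀ x)) (Ψ x) x₀
    rw [dist_comm (ΨC (f₀ x)) (Ψ x)] at ht
    linarith [fdist x hx, hx.2]
  have f3 : ∀ x ∈ R, (f₀ x).1 = x.1 := fun x hx => hcompat x hx.1 hx.2 (f₀ x) (f2 x hx) (fdist x hx)
  have f4 : ∀ x ∈ R, ∀ y ∈ R, BarlowAdj τS x y → BarlowAdj τC (f₀ x) (f₀ y) := by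
    intro x hx y hy hb
    have hb' : IsBond (lab₀ (Ψ x)) (lab₀ (Ψ y)) :=
      hl₂ _ ⟨hx.1.1, hx.1.2.2⟩ _ ⟨hy.1.1, hy.1.2.2⟩ hx.1.2.1 hy.1.2.1 ((hexS x y).2 hb)
    rw [← f1 x hx, ← f1 y hy] at hb'
    exact (hchart.2.2 (f₀ x) (f2 x hx) (f₀ y) (f2 y hy)).1 hb'
  have f5 : Set.InjOn f₀ R := by
    intro x hx y hy h
    have h' : lab₀ (Ψ x) = lab₀ (Ψ y) := by rw [← f1 x hx, ← f1 y hy, h]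
    exact hinjS x y (hl₃ ⟨⟨hx.1.1, hx.1.2.2⟩, hx.1.2.1⟩ ⟨⟨hy.1.1, hy.1.2.2⟩, hy.1.2.1⟩ h')
  -- ★ the combinatorial extension (tree-candidate ZI)
  obtain ⟨F, hF1, hFinj, hFaff, hFhom, hFpin⟩ := comb_extension τS τC R f₀ base kLo kHi f3 f4 f5 hbase hweld
  -- coordinates of atoms; inner atoms
  have hcrdex : ∀ p : E3, ∃ x : ℤ × ℤ × ℤ, p ∈ S → Ψ x = p := by
    intro p
    by_cases hp : p ∈ S
    · obtain ⟨x, hx⟩ := hsurj p hp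
      exact ⟨x, fun _ => hx⟩
    · exact ⟨(0, 0, 0), fun h => absurd h hp⟩
  choose crd hcrd using hcrdex
  have hcore : ∀ p ∈ S, (∃ k ∈ K, dist p k < ℓ) → p ∉ moatIn S K r ℓ → crd p ∈ I := by
    intro p hp hz hm
    show Ψ (crd p) ∈ coreOf S K r
    rw [hcrd p hp]
    by_contra hc
    exact hm ⟨hp, hz, fun y hy => not_le.1 fun hle => hc ⟨hp, y, hy, hle⟩⟩
  have hI_not_moat : ∀ x ∈ I, Ψ x ∉ moatIn S K r ℓ := by
    intro x hx hm
    have hx' : Ψ x ∈ coreOf S K r := hx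
    obtain ⟨-, k, hk, hle⟩ := hx'
    exact absurd hle (not_le.2 (hm.2.2 k hk))
  -- ★ localisation of inner labels by betweenness (on the linear skeleton, then within η)
  have innerLoc : ∀ x ∈ I, dist (ΨC (F x)) x₀ ≤ R₀ + ε + 2 * η := by
    intro x hx
    obtain ⟨hk1, hk2⟩ := hIrng x hx
    obtain ⟨m, n₁, n₂, hn₁, hn₂, hx₁, hx₂⟩ := hbtw x hx
    obtain ⟨a₀, j₀, e₀, hFk⟩ := hFaff x.1
    have key : ∀ n : ℤ, (x.1, x.2 + n • loDir m) ∈ B →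
        dist (Λ₀ (F (x.1, x.2)) + (n : ℝ) • ((((loRot j₀ e₀ (loDir m)).1 : ℤ) : ℝ) • b₁ +
          (((loRot j₀ e₀ (loDir m)).2 : ℤ) : ℝ) • b₂)) x₀ ≤ R₀ + ε + η := by
      intro n hn
      have hnR : (x.1, x.2 + n • loDir m) ∈ R := hPR (hBP hn)
      have hpinned : F (x.1, x.2 + n • loDir m) = f₀ (x.1, x.2 + n • loDir m) :=
        hFpin _ (hpin _ (hBP hn) hk1.le hk2.le)
      have e : Λ₀ (F (x.1, x.2)) + (n : ℝ) • ((((loRot j₀ e₀ (loDir m)).1 : ℤ) : ℝ) • b₁ +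
          (((loRot j₀ e₀ (loDir m)).2 : ℤ) : ℝ) • b₂) = Λ₀ (F (x.1, x.2 + n • loDir m)) := by
        rw [hFk, hFk, loRot_add, loRot_zsmul, ← add_assoc a₀ (loRot j₀ e₀ x.2) _, hΛ₀, linChart_add_zsmul]
      rw [e, hpinned]
      have ht := dist_triangle (ΨC (f₀ (x.1, x.2 + n • loDir m))) (Ψ (x.1, x.2 + n • loDir m)) x₀
      rw [dist_comm (ΨC _) (Ψ _)] at ht
      have ht' := dist_triangle (Λ₀ (f₀ (x.1, x.2 + n • loDir m))) (ΨC (f₀ (x.1, x.2 + n • loDir m))) x₀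
      rw [dist_comm (Λ₀ _) (ΨC _)] at ht'
      linarith [fdist _ hnR, hn.2, hlin (f₀ (x.1, x.2 + n • loDir m))]
    have k₂ := key (-n₂) hx₂
    rw [Int.cast_neg] at k₂
    have hΛ : dist (Λ₀ (F x)) x₀ ≤ R₀ + ε + η :=
      dist_le_of_between (Int.cast_pos.2 hn₁) (Int.cast_pos.2 hn₂) (key n₁ hx₁) k₂
    have ht := dist_triangle (ΨC (F x)) (Λ₀ (F x)) x₀
    linarith [hlin (F x)]
  have innerD : ∀ x ∈ I, dist (ΨC (F x)) x₀ ≤ RC := fun x hx => (innerLoc x hx).trans hRC₀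
  -- inner–cool bonds and collisions
  have bondIC : ∀ p ∈ S, (∃ k ∈ K, dist p k < ℓ) → p ∉ moatIn S K r ℓ → ∀ p', p' ∈ moatIn S K r ℓ → IsBond p p' →
      IsBond (ΨC (F (crd p))) (lab₀ p') := by
    intro p hp hz hm p' hm' hb
    have hx := hcore p hp hz hm
    obtain ⟨hk1, hk2⟩ := hIrng _ hx
    have hp'S : p' ∈ S := hm'.1
    have hadj' : BarlowAdj τS (crd p) (crd p') := (hexS _ _).1 (by rw [hcrd p hp, hcrd p' hp'S]; exact hb)
    rcases hadj _ hx _ hadj' with hI' | hP'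
    · exfalso
      apply hI_not_moat _ hI'
      rw [hcrd p' hp'S]
      exact hm'
    · have hsh := barlowAdj_sheets hadj'
      have hpn : F (crd p') = f₀ (crd p') := hFpin _ (hpin _ hP' (by omega) (by omega))
      have hb2 := hFhom _ _ hk1.le hk2.le (by omega) (by omega) hadj'
      rw [hpn] at hb2
      have hR' : crd p' ∈ R := hPR hP'
      have hb3 := (hchart.2.2 _ (innerD _ hx) _ (f2 _ hR')).2 hb2
      rwa [f1 _ hR', hcrd p' hp'S] at hb3
  have collIC : ∀ p ∈ S, (∃ k ∈ K, dist p k < ℓ) → p ∉ moatIn S K r ℓ → ∀ p', p' ∈ moatIn S K r ℓ →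
      ΨC (F (crd p)) = lab₀ p' → p = p' := by
    intro p hp hz hm p' hm' h
    have hx := hcore p hp hz hm
    obtain ⟨hk1, hk2⟩ := hIrng _ hx
    have hp'S : p' ∈ S := hm'.1
    by_cases hd : dist p' x₀ ≤ Rp
    · have hP' : crd p' ∈ P := ⟨by rw [hcrd p' hp'S]; exact hm', by rw [hcrd p' hp'S]; exact hd⟩
      have hR' : crd p' ∈ R := hPR hP'
      have e1 : f₀ (crd p') = F (crd p) :=
        hchart.1 (f2 _ hR') (innerD _ hx) (by rw [f1 _ hR', hcrd p' hp'S, h])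
      have hs : (crd p').1 = (crd p).1 := by rw [← f3 _ hR', e1, hF1]
      have hpn : F (crd p') = f₀ (crd p') := hFpin _ (hpin _ hP' (by omega) (by omega))
      have e2 : crd p' = crd p := hFinj (by rw [hpn, e1])
      rw [← hcrd p hp, ← hcrd p' hp'S, e2]
    · rw [not_le] at hd
      exfalso
      have hdε : dist p' (lab₀ p') ≤ ε := hl₄ p' ⟨hp'S, hm'.2.2⟩ hm'.2.1 hm'.2.2
      have ht := dist_triangle p' (lab₀ p') x₀
      rw [← h] at ht hdε
      linarith [innerLoc _ hx]
  -- ★ the label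
  set lab : E3 → E3 := fun p => if p ∈ moatIn S K r ℓ then lab₀ p else ΨC (F (crd p)) with hlab
  have labC : ∀ p, p ∈ moatIn S K r ℓ → lab p = lab₀ p := fun p h => if_pos h
  have labI : ∀ p, p ∉ moatIn S K r ℓ → lab p = ΨC (F (crd p)) := fun p h => if_neg h
  refine ⟨lab, ?_, ?_, ?_, ?_⟩
  · -- (i) values in C
    intro p hp hz
    by_cases hm : p ∈ moatIn S K r ℓ
    · rw [labC p hm]; exact hl₁ p ⟨hp, hm.2.2⟩ hz
    · rw [labI p hm]; exact hchart.2.1 (innerD _ (hcore p hp hz hm))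
  · -- (ii) bonds
    intro p hp p' hp' hz hz' hb
    by_cases hm : p ∈ moatIn S K r ℓ <;> by_cases hm' : p' ∈ moatIn S K r ℓ
    · rw [labC p hm, labC p' hm']; exact hl₂ p ⟨hp, hm.2.2⟩ p' ⟨hp', hm'.2.2⟩ hz hz' hb
    · rw [labC p hm, labI p' hm']; exact (bondIC p' hp' hz' hm' p hm hb.symm).symm
    · rw [labI p hm, labC p' hm']; exact bondIC p hp hz hm p' hm' hb
    · rw [labI p hm, labI p' hm']
      have hx := hcore p hp hz hm
      have hx' := hcore p' hp' hz' hm'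
      have hadj' : BarlowAdj τS (crd p) (crd p') := (hexS _ _).1 (by rw [hcrd p hp, hcrd p' hp']; exact hb)
      obtain ⟨hk1, hk2⟩ := hIrng _ hx
      obtain ⟨hk1', hk2'⟩ := hIrng _ hx'
      exact (hchart.2.2 _ (innerD _ hx) _ (innerD _ hx')).2 (hFhom _ _ hk1.le hk2.le hk1'.le hk2'.le hadj')
  · -- (iii) injectivity on the zone
    rintro p ⟨hp, hz⟩ p' ⟨hp', hz'⟩ h
    by_cases hm : p ∈ moatIn S K r ℓ <;> by_cases hm' : p' ∈ moatIn S K r ℓ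
    · rw [labC p hm, labC p' hm'] at h; exact hl₃ ⟨⟨hp, hm.2.2⟩, hz⟩ ⟨⟨hp', hm'.2.2⟩, hz'⟩ h
    · rw [labC p hm, labI p' hm'] at h; exact (collIC p' hp' hz' hm' p hm h.symm).symm
    · rw [labI p hm, labC p' hm'] at h; exact collIC p hp hz hm p' hm' h
    · rw [labI p hm, labI p' hm'] at h
      have hx := hcore p hp hz hm
      have hx' := hcore p' hp' hz' hm'
      have e := hFinj (hchart.1 (innerD _ hx) (innerD _ hx') h)
      rw [← hcrd p hp, ← hcrd p' hp', e]
  · -- (iv) the cool atoms move by at most ε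
    intro p hp hz hc
    rw [labC p ⟨hp, hz, hc⟩]
    exact hl₄ p ⟨hp, hc⟩ hz hc

/-! ## ZQ-3  NODE 79 of record -/

/-- ★★★ **NODE 79 JUNCTION OF RECORD (PROVED)**: (GL) `BondLabelP` ⟸ (L2-S) `DoorChartPinningP … 14 (57/4) (82/5)` [open, NODE 78] ∧ (L2-C⟂)
`CoolShadowLinearChartObliqueP … (82/5) (821/50) (1/100)` [open] — the parallel case being the theorem `coolShadowLinearChart_parallel_record` (ZP) and
the empty corner vacuous. [this file] -/
theorem bondLabelP_record_of_oblique (ϑc : ℝ)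
    (hPin : DoorChartPinningP ϑc (1 / 10) 8 4 12 16 (17 / 20) (1 / 10000) 5 (1 / 10000) 10 (43 / 2) 1 2 (1 / 16) (1 / 50)
      14 (57 / 4) (82 / 5))
    (hO : CoolShadowLinearChartObliqueP ϑc (1 / 10) 8 4 12 16 (17 / 20) (1 / 10000) 5 (1 / 10000) 10 (43 / 2) 1 2 (1 / 16) (1 / 50)
      (82 / 5) (821 / 50) (1 / 100)) :
    BondLabelP ϑc (1 / 10) 8 4 12 16 (17 / 20) (1 / 10000) 5 (1 / 10000) 10 (43 / 2) 1 2 (1 / 16) (1 / 50) :=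
  bondLabelP_of_pinning_linearChart_nonempty (RC := 821 / 50) (η := 1 / 100) (by norm_num) (by norm_num) (by norm_num) (by norm_num) (by norm_num)
    (by norm_num) (by norm_num) hPin (nonempty_of_parallel_oblique (coolShadowLinearChart_parallel_record ϑc) hO)

/-- the open piece of record follows from NODE 78's record (L2-C)(82/5, 33/2, 1/100): NODE 79 refines NODE 78. [formal bookkeeping] -/
theorem oblique_record_of_coolShadowLinearChartP_record (ϑc : ℝ)
    (h : CoolShadowLinearChartP ϑc (1 / 10) 8 4 12 16 (17 / 20) (1 / 10000) 5 (1 / 10000) 10 (43 / 2) 1 2 (1 / 16) (1 / 50)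
      (82 / 5) (33 / 2) (1 / 100)) :
    CoolShadowLinearChartObliqueP ϑc (1 / 10) 8 4 12 16 (17 / 20) (1 / 10000) 5 (1 / 10000) 10 (43 / 2) 1 2 (1 / 16) (1 / 50)
      (82 / 5) (821 / 50) (1 / 100) :=
  (cases_record_of_coolShadowLinearChartP_record ϑc h).1

end Summit.AtomisticToContinuum.Crystallization.Theorems.ChartedZeroExcessLayeredLatticeLiouville
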